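import Literature.AlgebraicGeometry.HodgeTheory.AmpleDivisorOfPositiveClass
import Literature.AlgebraicGeometry.Motives.AbelianVarietyAmpleRiemannForm
import Literature.AlgebraicGeometry.Motives.AbelianVarietyPicZeroOfAmple
import HarnessLib

/-!
# Lefschetz over `ℂ`: an ample divisor `Θ` on a complex abelian variety has `3 • Θ` VERY AMPLE —
# the theta closed immersion `Ψ : A ⟶ ℙᴺ_ℂ` with `3 • Θ ∼ H_Ψ`

Layer `Literature/AlgebraicGeometry/HodgeTheory`, namespace `Literature.AlgebraicGeometry.HodgeTheory`.  THEOREMS ONLY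
(no definition, no named fact, no instance, no notation).  Cell `hodgecm-mathlib` (D-0151), F-DAG LEFSCHETZ row, brick
(B1) of the census `CENSUS-L1-Lefschetz3ThetaVeryAmple` (B-p16 (g15), sha16 1f9187eb): the `ℂ`-analytic input of
«`Θ` ample on an abelian variety ⟹ `3 • Θ` very ample by the complete linear system» (Mumford, *Abelian Varieties*
§17 Theorem; over `ℂ` the Theorem of Lefschetz, §3), consumed by (B2) `Motives/CompleteLinearSystemClosedImmersion`
(«very ample ⟹ every spanning family of `Γ(𝒪(3Θ))` embeds») and (B4) `AbelianVarieties/LefschetzThreeThetaVeryAmple`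
(the socket over any field of characteristic `0`, by descent), feeding the F-6 functor side (fibre embedding by the
complete linear system of `L^Δ(λ)_t^{⊗3}`).

WHAT IS NEW.  ★ `HodgeTheory/AmpleDivisorOfPositiveClass.exists_isAmple_picClass_eq_toPic_pow_three` BUILDS, in its
proof, the algebraised theta embedding `Ψ : A ⟶ ℙᴺ_ℂ` of a uniformised complex abelian variety with
`[𝒪_A(H_Ψ)^an] = L(H, χ)³`, but EXPORTS only «some AMPLE divisor has class `L(H, χ)³`».  This file re-threads the same
four steps with the stronger export — the closed immersion itself and its hyperplane divisor — and then reads the class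
identity through GAGA injectivity on `Pic`:

* `exists_isClosedImmersion_picClass_divisor_eq_toPic_pow_three` (ENGINE, uniformised form) — for `A` uniformised by
  `φ : ℂ^g/Φ(ℤ^ι) → A(ℂ)` and an Appell–Humbert datum `p = (H, χ)` with `Im H` a Riemann form: a closed immersion
  `Ψ : A.X ⟶ ℙᴺ_ℂ` over `ℂ` and a coordinate `x_{a₀}` (with `A ⊄ V(x_{a₀})`) such that the hyperplane divisor
  `H_Ψ = (Ψ^*x_{a₀})` (`(GeneratingSections.ofHom Ψ.left).divisor a₀ _`, Hartshorne II Thm. 7.1) satisfies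
  `[𝒪_A(H_Ψ)^an] = (AHData.toPic p)³` in Lange's `Pic(X)`.  Proof = steps 1–4 of the ★ proof verbatim
  (★ `IsRiemannForm.exists_toPic_eq_translate_pullback_siegelFactor`, ★ `exists_lefschetz_levelThree_family_typeD_of_posDef`,
  ★ `ComplexTorus.exists_embedding_of_lefschetzFamily_eq_mk`, Chow/GAGA ★ `exists_smoothProjective_of_projectiveEmbedding`,
  ★ `exists_iso_of_isAnalytification`, ★ `picClass_cartierDivisorLineBundle_divisor_eq_toPic`).
* `exists_isClosedImmersion_linEquiv_three_nsmul_of_toPic_eq` (uniformised head) and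
  **`AbelianVariety.exists_isClosedImmersion_linEquiv_three_nsmul`** (THE HEAD, uniformisation-free): for `Θ` AMPLE on a
  complex abelian variety `A` there are `N`, a closed immersion `Ψ : A.X ⟶ ℙᴺ_ℂ` and a coordinate `x_{a₀}` with
  **`(3 • Θ).LinEquiv H_Ψ`** — «`3 • Θ` is very ample», in the tree's very-ampleness spelling of ★
  `CartierDivisor.IsAmple.exists_smul_linEquiv_divisor` with the exponent `q = 3` FIXED.  Proof: ★
  `exists_uniformisation_isRiemannForm_of_isAmple` (ample ⟹ `c₁(Θ)` is a Riemann-form datum `p` with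
  `toPic p = [𝒪(Θ)^an]`), the engine, ★ `picClass_cartierDivisorLineBundle_nsmul` (`[𝒪(3•Θ)^an] = [𝒪(Θ)^an]³`), and GAGA
  injectivity on `Pic` ★ `AbelianVariety.linEquiv_of_picClass_eq` (Serre n° 20 Prop. 18, through ★
  `linEquiv_of_analyticallyEquivalent_cartierDivisorCocycle`).

Everything is proved; 0 new facts; characteristic `0` over `ℂ` only (the spread to any field of characteristic `0` is (B4)).
HC_CM is proved only modulo the 7 printed citations until rung 0 closes; nothing here is about HC.

## References
* [MumfordAV1970] D. Mumford, *Abelian Varieties* (1970), §3 (Theorem of Lefschetz, pp. 29–33) and §17 (Theorem: `L` ample ⟹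
  `L³` very ample); §6 Application 1 (p. 60).
* [LangeBirkenhake1992] H. Lange, Ch. Birkenhake, *Complex Abelian Varieties* (1992), Thm. 4.5.1 (Lefschetz).
* [Lange2023AbelianVarietiesComplex] H. Lange, *Abelian Varieties over the Complex Numbers* (2023), §2.1.3 Thm. 2.1.10 and
  Prop. 2.1.11 (pp. 79–80); §1.2.1 Prop. 1.2.2–1.2.3 (p. 21).
* [SerreGAGA1956] J.-P. Serre, *Géométrie algébrique et géométrie analytique* (1956), n° 20 Prop. 18 and Remarque 1.
* [Hartshorne1977] R. Hartshorne, *Algebraic Geometry* (GTM 52), II Thm. 7.1 (a) (p. 150).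
* [GortzWedhorn2020] U. Görtz, T. Wedhorn, *Algebraic Geometry I* (2nd ed. 2020), Prop. 13.47 (pp. 392–393).
-/

noncomputable section

open scoped Manifold ContDiff Topology LinearAlgebra.Projectivization Real
open CategoryTheory AlgebraicGeometry Complex
open Literature.AlgebraicGeometry.Motives Literature.AlgebraicGeometry.Motives.AlgPoints
  Literature.AlgebraicGeometry.Motives.AnalytificationKaehler
  Literature.NumberTheory.Transcendental Literature.Geometry.Kaehler Literature.Geometry.Kaehler.ComplexTorus
  Literature.Analysis.SpecialFunctions

namespace Literature.AlgebraicGeometry.HodgeTheory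

/-! ### §1 The engine: the algebraised theta embedding and the class of its hyperplane divisor -/

/-- **Lefschetz's theorem over `ℂ`, uniformised ENGINE: the theta closed immersion and `[𝒪_A(H_Ψ)^an] = L(H, χ)³`.**
For a complex abelian variety `A` uniformised by `φ : ℂ^g/Φ(ℤ^ι) → A(ℂ)` and an Appell–Humbert datum `p = (H, χ)`
whose form is a Riemann form, there are `N`, a CLOSED IMMERSION `Ψ : A.X ⟶ ℙᴺ_ℂ` over `ℂ` and a homogeneous coordinate
`x_{a₀}` not vanishing at the generic point such that the hyperplane divisor `H_Ψ = (Ψ^* x_{a₀})` has analytified line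
bundle of class `(AHData.toPic p)³`.  `Ψ` is the algebraisation (Chow + GAGA + uniqueness of the algebraic structure) of
the level-three theta map `π(v) ↦ [f_k(F(v + u))]_k` of Lange–Birkenhake Thm. 4.5.1 / Mumford §3 — the proof of ★
`exists_isAmple_picClass_eq_toPic_pow_three`, exported with `Ψ`.
[cite: LangeBirkenhake1992, Thm. 4.5.1] [cite: MumfordAV1970, §3 pp. 29–33]
[cite: Lange2023AbelianVarietiesComplex, §2.1.3 Thm. 2.1.10 and Prop. 2.1.11 (pp. 79–80)] [cite: Hartshorne1977, II Thm. 7.1 (a)] -/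
theorem exists_isClosedImmersion_picClass_divisor_eq_toPic_pow_three (A : AbelianVariety ℂ) (ι : Type) [Fintype ι]
    [DecidableEq ι] (Φ : (ι → ℝ) ≃L[ℝ] (Fin A.dim → ℂ)) (φ : ComplexTorus Φ → ComplexPoints A.X)
    (hφ : IsAnalytification (Fin A.dim → ℂ) A.X A.dim φ) (p : AHData Φ) (hp : IsRiemannForm Φ p.form) :
    ∃ (N : ℕ) (Ψ : A.X ⟶ projectiveSpace N ℂ) (_ : IsClosedImmersion Ψ.left) (a₀ : Fin (N + 1))
      (ha₀ : genericPoint A.X.left ∈ (GeneratingSections.ofHom (k := ℂ) (ι := Fin (N + 1)) Ψ.left).U a₀),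
      picClass (cartierDivisorLineBundle hφ
          ((GeneratingSections.ofHom (k := ℂ) (ι := Fin (N + 1)) Ψ.left).divisor a₀ ha₀)) =
        AHData.toPic p ^ 3 := by
  classical
  /- Step 1: `L(H, χ) = t_ū^* f^* [e[0;0]]` for an isomorphism with a Siegel torus of type `D`. -/
  obtain ⟨g, d, Ω, Φ', P, Q, F, G, hΩ, hΦ', hPF, u, hd, hpos, hPQ, hQP, hGF, hFG, -, hclass⟩ :=
    ComplexTorus.IsRiemannForm.exists_toPic_eq_translate_pullback_siegelFactor Φ p hp
  set t : Factor Φ := Factor.translate Φ u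
    (Factor.pullback Φ Φ' hPF ⟨siegelFactor Ω, isFactor_siegelFactor_typeD Ω d Φ' hΦ' hΩ⟩) with ht
  have ht_apply : ∀ l v, t l v = siegelFactor Ω (P.mulVec l) (F (v + u)) := fun l v ↦ rfl
  /- the level-three theta functions of type `D` on the Siegel side -/
  obtain ⟨f, hfd, hper, hqper, hbpf, hinj, himm⟩ := exists_lefschetz_levelThree_family_typeD_of_posDef Ω hΩ hpos d hd
  -- their quasi-periodicity along `Dℤ^g ⊕ Ωℤ^g`, factor `e[0;0]³`
  have hquasi : ∀ k (w : Fin g ⊕ Fin g → ℤ) (z : Fin g → ℂ),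
      f k (z + ComplexTorus.latticeVec Φ' w) = siegelFactor Ω w z ^ 3 * f k z := by
    intro k w z
    set m : Fin g → ℤ := fun i ↦ w (Sum.inl i) with hm
    set n' : Fin g → ℤ := fun j ↦ w (Sum.inr j) with hn'
    have hz : z + ComplexTorus.latticeVec Φ' w =
        fun i ↦ (fun i ↦ z i + ∑ j, Ω i j * (n' j : ℂ)) i + (d i : ℂ) * (m i : ℂ) := by
      funext i
      rw [Pi.add_apply, latticeVec_siegel_typeD Ω d Φ' hΦ' w i]
      simp only [hm, hn']
      ring
    rw [hz, hper, hqper, siegelFactor_apply, ← Complex.exp_nat_mul]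
    push_cast
    simp only [hn']
  /- Step 2: the Lefschetz family `g_k(v) = f_k(F(v + u))` on `X` and its common factor `t³`. -/
  have hgq : ∀ k (l : ι → ℤ) (v : Fin A.dim → ℂ),
      f k (F (v + ComplexTorus.latticeVec Φ l + u)) = t l v ^ 3 * f k (F (v + u)) := by
    intro k l v
    rw [ht_apply, add_right_comm, map_add, ComplexTorus.apply_latticeVec_eq Φ Φ' hPF, hquasi]
  have hgd : ∀ k, Differentiable ℂ (fun v : Fin A.dim → ℂ ↦ f k (F (v + u))) := fun k ↦
    (hfd k).comp (F.differentiable.comp (differentiable_id.add_const u))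
  obtain ⟨N, σ, FA, hFAs, hFAi, hFAm, hFAc⟩ := ComplexTorus.exists_embedding_of_lefschetzFamily_eq_mk Φ
    (fun k v ↦ f k (F (v + u))) hgd
    (fun v l ↦ ⟨t l v ^ 3, fun k ↦ hgq k l v⟩)
    (fun v ↦ hbpf (F (v + u)))
    (by
      intro z₁ z₂ γ hγ
      obtain ⟨m, n', hmn⟩ := hinj (F (z₁ + u)) (F (z₂ + u)) γ hγ
      refine ⟨Q.mulVec (Sum.elim m n'), ?_⟩
      have hsub : F (z₂ + u) - F (z₁ + u) = ComplexTorus.latticeVec Φ' (Sum.elim m n') := by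
        funext i
        rw [Pi.sub_apply, hmn i, latticeVec_siegel_typeD Ω d Φ' hΦ']
        simp only [Sum.elim_inl, Sum.elim_inr]
      have hF' : F (z₂ - z₁) = F (ComplexTorus.latticeVec Φ (Q.mulVec (Sum.elim m n'))) := by
        rw [ComplexTorus.apply_latticeVec_eq Φ Φ' hPF, Matrix.mulVec_mulVec, hPQ, Matrix.one_mulVec, ← hsub,
          ← map_sub, add_sub_add_right_eq_sub]
      have hG' := congrArg G hF'
      rw [hGF, hGF] at hG'
      rw [← hG', add_sub_cancel])
    (by
      intro z v μ hv
      have hderiv : ∀ k, fderiv ℂ (fun x : Fin A.dim → ℂ ↦ f k (F (x + u))) z v =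
          fderiv ℂ (f k) (F (z + u)) (F v) := by
        intro k
        have h1 : HasFDerivAt (fun x : Fin A.dim → ℂ ↦ F (x + u)) F z := by
          have h := F.hasFDerivAt.comp z ((hasFDerivAt_id z).add_const u)
          rwa [ContinuousLinearMap.comp_id] at h
        have h2 : HasFDerivAt (fun x : Fin A.dim → ℂ ↦ f k (F (x + u)))
            ((fderiv ℂ (f k) (F (z + u))).comp F) z :=
          ((hfd k) (F (z + u))).hasFDerivAt.comp z h1
        rw [h2.fderiv]
        rfl
      have hFv : F v = 0 := himm (F (z + u)) (F v) μ fun k ↦ by rw [← hderiv k]; exact hv k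
      have := congrArg G hFv
      rwa [hGF, map_zero] at this)
  /- Step 3: algebraise the image and identify it with `A`. -/
  obtain ⟨X', ι', hι', hX'red, ψ, hψ, hcomp, hX'⟩ :=
    Literature.AlgebraicGeometry.AbelianVarieties.exists_smoothProjective_of_projectiveEmbedding FA hFAs hFAi hFAm
  obtain ⟨e, he, -⟩ := exists_iso_of_isAnalytification
    (AbelianVariety.isSmoothProjective_holds (A := A)) hX' hφ hψ
  set Ψ : A.X ⟶ projectiveSpace N ℂ := e.hom ≫ ι' with hΨ
  have hmap : ∀ x, projPoint N (FA x) = AlgPoints.map Ψ (φ x) := fun x ↦ by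
    rw [hΨ, AlgPoints.map_comp_apply, ← he x, hcomp x]
  haveI : IsIso e.hom.left := ((Over.forget _).mapIso e).isIso_hom
  haveI hΨcl : IsClosedImmersion Ψ.left := by
    change IsClosedImmersion (e.hom.left ≫ ι'.left)
    infer_instance
  /- Step 4: the hyperplane divisor `H_Ψ = (Ψ^* x_{k₀})` has class `⟦t³⟧ = L(H, χ)³`. -/
  obtain ⟨k₀, hk₀⟩ := (GeneratingSections.affineChartData Ψ).exists_mem_U (genericPoint A.X.left)
  refine ⟨N, Ψ, hΨcl, k₀, hk₀, ?_⟩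
  -- the homogeneous coordinates of `Ψ(ℂ) ∘ φ ∘ π` are the `g_k`
  have hne : ∀ v : Fin A.dim → ℂ, (fun j ↦ f (σ j) (F (v + u))) ≠ 0 := by
    intro v h0
    obtain ⟨k, hk⟩ := hbpf (F (v + u))
    exact hk (by simpa using congrFun h0 (σ.symm k))
  have hdom : ∀ c v, ComplexTorus.cover Φ v ∈ chartDom Ψ φ c ↔ f (σ c) (F (v + u)) ≠ 0 := by
    intro c v
    rw [mem_chartDom_iff_comp Ψ φ (projPoint N) FA hmap c, hFAc v (hne v)]
    exact mem_chartDom_id_projPoint_mk_iff N _ (hne v) c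
  have hcoord : ∀ c d' v, ComplexTorus.cover Φ v ∈ chartDom Ψ φ d' →
      coordFun Ψ φ d' (ComplexTorus.cover Φ v) c = f (σ c) (F (v + u)) / f (σ d') (F (v + u)) := by
    intro c d' v hv
    rw [coordFun_eq_coordFun_id_comp Ψ φ (projPoint N) FA hmap d', Function.comp_apply, hFAc v (hne v)]
    exact coordFun_id_projPoint_mk N _ ((hdom d' v).1 hv) (hne v) c
  have hθe : ∀ c (l : ι → ℤ) v, f (σ c) (F (v + ComplexTorus.latticeVec Φ l + u)) =
      (t ^ 3) l v * f (σ c) (F (v + u)) := by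
    intro c l v
    rw [hgq, pow_three', pow_three', Factor.mul_apply, Factor.mul_apply]
  have key := picClass_cartierDivisorLineBundle_divisor_eq_toPic hφ Ψ k₀ hk₀ (t ^ 3).isFactor
    (fun c v ↦ f (σ c) (F (v + u))) (fun c ↦ hgd (σ c)) hθe hdom hcoord
  rw [key, hclass, ← map_pow Factor.toPic t 3]

/-! ### §2 The head: `3 • Θ` is very ample for `Θ` ample -/

/-- **Lefschetz over `ℂ`, uniformised head.**  For `A` uniformised by `φ`, an Appell–Humbert datum `p` with
`toPic p = [𝒪_A(Θ)^an]` whose form is a Riemann form (★ `isRiemannForm_of_isAmple` supplies this for `Θ` ample):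
there is a closed immersion `Ψ : A.X ⟶ ℙᴺ_ℂ` whose hyperplane divisor `H_Ψ = (Ψ^*x_{a₀})` satisfies BOTH
`[𝒪_A(H_Ψ)^an] = (toPic p)³` AND **`3 • Θ ∼ H_Ψ`** (GAGA injectivity on `Pic`, ★ `AbelianVariety.linEquiv_of_picClass_eq`,
with ★ `picClass_cartierDivisorLineBundle_nsmul`). [cite: MumfordAV1970, §17] [cite: LangeBirkenhake1992, Thm. 4.5.1]
[cite: SerreGAGA1956, n° 20 Prop. 18 and Remarque 1] [cite: Lange2023AbelianVarietiesComplex, §1.2.1 Prop. 1.2.2–1.2.3 (p. 21)] -/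
theorem exists_isClosedImmersion_linEquiv_three_nsmul_of_toPic_eq (A : AbelianVariety ℂ) (ι : Type) [Fintype ι]
    [DecidableEq ι] (Φ : (ι → ℝ) ≃L[ℝ] (Fin A.dim → ℂ)) (φ : ComplexTorus Φ → ComplexPoints A.X)
    (hφ : IsAnalytification (Fin A.dim → ℂ) A.X A.dim φ) (Θ : CartierDivisor A.X.left) (p : AHData Φ)
    (hpΘ : AHData.toPic p = picClass (cartierDivisorLineBundle hφ Θ)) (hp : IsRiemannForm Φ p.form) :
    ∃ (N : ℕ) (Ψ : A.X ⟶ projectiveSpace N ℂ) (_ : IsClosedImmersion Ψ.left) (a₀ : Fin (N + 1))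
      (ha₀ : genericPoint A.X.left ∈ (GeneratingSections.ofHom (k := ℂ) (ι := Fin (N + 1)) Ψ.left).U a₀),
      picClass (cartierDivisorLineBundle hφ
          ((GeneratingSections.ofHom (k := ℂ) (ι := Fin (N + 1)) Ψ.left).divisor a₀ ha₀)) = AHData.toPic p ^ 3 ∧
        (3 • Θ).LinEquiv ((GeneratingSections.ofHom (k := ℂ) (ι := Fin (N + 1)) Ψ.left).divisor a₀ ha₀) := by
  obtain ⟨N, Ψ, hΨ, a₀, ha₀, hcl⟩ := exists_isClosedImmersion_picClass_divisor_eq_toPic_pow_three A ι Φ φ hφ p hp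
  refine ⟨N, Ψ, hΨ, a₀, ha₀, hcl, A.linEquiv_of_picClass_eq hφ ?_⟩
  rw [picClass_cartierDivisorLineBundle_nsmul hφ, ← hpΘ, hcl]

/-- **Lefschetz's theorem over `ℂ` — `Θ` ample ⟹ `3 • Θ` VERY AMPLE** (Mumford §17 Theorem for `k = ℂ`; Lange–Birkenhake
Thm. 4.5.1): for an AMPLE Cartier divisor `Θ` on a complex abelian variety `A` there are `N`, a closed immersion
`Ψ : A.X ⟶ ℙᴺ_ℂ` over `ℂ` and a homogeneous coordinate `x_{a₀}` (not vanishing at the generic point) with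
**`(3 • Θ).LinEquiv H_Ψ`**, `H_Ψ = (Ψ^* x_{a₀})` the hyperplane divisor of Hartshorne II Thm. 7.1 — the very-ampleness
spelling of ★ `CartierDivisor.IsAmple.exists_smul_linEquiv_divisor` with the exponent `3`.  Proof: `c₁(Θ)` is a
Riemann-form datum (★ `exists_uniformisation_isRiemannForm_of_isAmple`), the engine of §1, GAGA on `Pic`.
[cite: MumfordAV1970, §17] [cite: LangeBirkenhake1992, Thm. 4.5.1] [cite: Lange2023AbelianVarietiesComplex, §2.1.3 Thm. 2.1.10]
[cite: SerreGAGA1956, n° 20 Prop. 18 and Remarque 1] [cite: Hartshorne1977, II Thm. 7.1 (a)] -/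
theorem _root_.Literature.AlgebraicGeometry.Motives.AbelianVariety.exists_isClosedImmersion_linEquiv_three_nsmul
    (A : AbelianVariety ℂ) {Θ : CartierDivisor A.X.left} (hΘ : Θ.IsAmple) :
    ∃ (N : ℕ) (Ψ : A.X ⟶ projectiveSpace N ℂ) (_ : IsClosedImmersion Ψ.left) (a₀ : Fin (N + 1))
      (ha₀ : genericPoint A.X.left ∈ (GeneratingSections.ofHom (k := ℂ) (ι := Fin (N + 1)) Ψ.left).U a₀),
      (3 • Θ).LinEquiv ((GeneratingSections.ofHom (k := ℂ) (ι := Fin (N + 1)) Ψ.left).divisor a₀ ha₀) := by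
  classical
  obtain ⟨ι, _, _, Φ, φ, hφ, -, p, hp, hR⟩ := A.exists_uniformisation_isRiemannForm_of_isAmple hΘ
  obtain ⟨N, Ψ, hΨ, a₀, ha₀, -, hlin⟩ :=
    exists_isClosedImmersion_linEquiv_three_nsmul_of_toPic_eq A ι Φ φ hφ Θ p hp hR
  exact ⟨N, Ψ, hΨ, a₀, ha₀, hlin⟩

end Literature.AlgebraicGeometry.HodgeTheory

end
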